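import Summits.ABC.ABC.Theorems.RationalCuspPencilPencilFourBound
import Summits.ABC.ABC.Theorems.RationalCuspPencilSixTorsionDictionary
import Summits.ABC.ABC.Theorems.RationalCuspPencilSixTorsionPayoff
import HarnessLib

/-!
# Target `SixTorsionClassEpsShape` (stmt-ABC-24548, route `RationalCuspPencil`) — THE CLASS THEOREM, proved

`Summits/ABC/ABC/Theorems/RationalCuspPencilSixTorsionClassEpsShape.lean`: **Szpiro's conjecture
in ε-shape with exponent `1/4` for every elliptic curve over `ℚ` with a rational point of order
six**, on Kubert's Tate normal form: for every `ε > 0` there is `C` with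
`log |Δ_min(W)| ≤ C · N_W^{1/4+ε}` for all coprime `u, w` with `u w (u+w)(9u+w) ≠ 0` and every
elliptic `W = ⟨w−u, −u(u+w), −uw(u+w), 0, 0⟩ / ℚ`.

Assembly of the three proved items of the route (all by this seat, KEY PENCIL-ENGINE batch 58):
the pencil engine `pencilFourBound_proof` (stmt-ABC-24549; `k = 4` instance of the general pencil
theorem `pencil_log_height_le_rad_rpow`, Stewart–Yu 2001 Thm 2 transferred), the dictionary
`sixTorsionDictionary_proof` (stmt-ABC-24551; Tate's algorithm away from `6`), and the payoff
`sixTorsionPayoff_proof` (stmt-ABC-24552; real-analysis glue).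

HONESTY. This is an ε-COLUMN / SZPIRO-BY-CLASS RECORD (worst-case exponent `1/4` on the ℤ/6
class, where print has the all-curves `1+ε` of Murty–Pasten and the Frey-locus `1/3`): NOT abc,
NOT A-PS (polynomial Szpiro `|Δ_min| ≤ C·N^K` for ALL `E/ℚ`), NOT rung A1′; the route reaches
`ABC` only through its DECLARED RESIDUAL `SixTorsionResidual` (stmt-ABC-24550, never staffed);
abc distance = that residual. [cite: StewartYu2001, Theorem 2] [cite: Kubert1976, Table 3]
-/

set_option linter.dupNamespace false

namespace Summit.ABC.ABC.Theorems

/-- **Target `SixTorsionClassEpsShape` (stmt-ABC-24548) — proved**: for every `ε > 0` there is `C`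
such that every elliptic curve `E/ℚ` with a rational point of order six, in Kubert's normal form
`W(u,w) = ⟨w−u, −u(u+w), −uw(u+w), 0, 0⟩` (`gcd(u,w) = 1`, `uw(u+w)(9u+w) ≠ 0`), satisfies
`log|Δ_min| ≤ C · N^{1/4+ε}`. Proof: `sixTorsionPayoff_proof pencilFourBound_proof
sixTorsionDictionary_proof`. ε-shape `1/4` on the ℤ/6 class — NOT abc, NOT A-PS, NOT A1′.
[cite: StewartYu2001, Theorem 2] -/
theorem sixTorsionClassEpsShape_proof :
    Summit.ABC.ABC.Theses.RationalCuspPencil.SixTorsionClassEpsShape := by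
  have h := sixTorsionPayoff_proof
  unfold Summit.ABC.ABC.Theses.RationalCuspPencil.SixTorsionPayoff at h
  exact h pencilFourBound_proof sixTorsionDictionary_proof

end Summit.ABC.ABC.Theorems
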